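import Mathlib.RingTheory.MatrixAlgebra
import Literature.Computability.Complexity.AOWAccepts
import Literature.Computability.Complexity.AOWWalkMoments
import Literature.Computability.Complexity.AOWOddMoments
import HarnessLib

/-!
# The level tests on AOW's random instance: failure probabilities for fixed `n`
(Allen–O'Donnell–Witmer 2015, App. A.1–A.2 and Fact 3.6, quantitative form)

Trunk T-CPLX-CORE (Literature/Computability/Complexity). Support file for the discharge of the
named fact `allen_odonnell_witmer_kSAT` (`AOWRefutation.lean`), probabilistic part VIII: the
glue between the refuter's integer tests (`AOWAccepts.lean`) and the moment bounds
(`AOWWalkMoments.lean`, `AOWOddMoments.lean`) on the random constraint set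
`T ∼ subsetPMF (AOWConstraint k n) p` (AOW's `F_{OR_k}(n, p)`).

* **Sign balance** `sum_signAt_eq_zero`: over all sign patterns, `∑_c ∏_{i∈S} (±1)^{c_i} = 0` for
  `S ≠ ∅`; hence the integer level matrix / odd tensor of the sampled instance, cast to `ℝ`,
  ARE the centred random fiber matrix / tensor (`levelMatrix_toList_map_cast`,
  `oddTensor_toList_cast`) — no centring term survives.
* Fiber sizes: `card_filter_scope_comp_eq` (`#{C' : C'.1 ∘ e = C.1 ∘ e} = 2^k n^{k-c}` for an
  injective `e : [c] → [k]`), `card_filter_overTriple_le` (`2^k` labels over a triple).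
* **Failure bounds for fixed `n`** (Markov + Chebyshev): `subsetProb_card_lt_half_le`
  (`P[m < m̄/2] ≤ 4/m̄`), `subsetProb_not_levelCheck_le` and `subsetProb_not_oddCheck_le`.

## References

* S. R. Allen, R. O'Donnell, D. Witmer, *How to refute a random CSP*, FOCS 2015,
  arXiv:1505.04383: Fact 3.6 (concentration of `m`), Cor. 4.2 (`E[w(T)] = 0` by sign balance),
  App. A.1, A.2, A.4 (Markov on the trace).
-/

noncomputable section

namespace Literature.Computability.Complexity

open Finset Matrix

variable {k n : ℕ}

/-! ### Sign balance -/

/-- `pmSign (!b) = - pmSign b`. [folklore] -/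
@[simp] theorem pmSign_not (b : Bool) : pmSign (!b) = -pmSign b := by
  cases b <;> simp

/-- **Sign balance**: for a non-empty set of positions `S`, the signs of all `2^k` negation
patterns on `S` cancel: `∑_{c : [k] → Bool} ∏_{i ∈ S} (±1)^{c_i} = 0`.
[Allen–O'Donnell–Witmer 2015, Cor. 4.2 (`E[w(T)] = 0`)] [cite: arXiv150504383, Cor. 4.2] -/
theorem sum_prod_pmSign_eq_zero {S : Finset (Fin k)} (hS : S.Nonempty) :
    ∑ c : Fin k → Bool, ∏ i ∈ S, pmSign (c i) = 0 := by
  obtain ⟨i₀, hi₀⟩ := hS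
  have h : ∀ c : Fin k → Bool, ∏ i ∈ S, pmSign (c i) =
      ∏ i, (if i ∈ S then pmSign (c i) else 1) := fun c => (Fintype.prod_ite_mem S _).symm
  simp_rw [h]
  rw [← Fintype.prod_sum (fun i b => if i ∈ S then pmSign b else 1)]
  apply Finset.prod_eq_zero (Finset.mem_univ i₀)
  simp [hi₀]

/-- Sign balance over the constraints of a fiber: for `S ≠ ∅` and any condition `φ` on the SCOPE,
`∑_{C : φ C.1} signAt C S = 0`. [Allen–O'Donnell–Witmer 2015, Cor. 4.2] [cite: arXiv150504383, Cor. 4.2] -/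
theorem sum_signAt_eq_zero {S : Finset (Fin k)} (hS : S.Nonempty) (φ : (Fin k → Fin n) → Prop)
    [DecidablePred φ] (g : (Fin k → Fin n) → ℝ) :
    ∑ C : AOWConstraint k n, (if φ C.1 then g C.1 * (C.signAt S : ℝ) else 0) = 0 := by
  rw [Fintype.sum_prod_type]
  refine Finset.sum_eq_zero fun T _ => ?_
  dsimp only
  split_ifs
  · rw [← Finset.mul_sum]
    convert mul_zero (g T)
    have := sum_prod_pmSign_eq_zero (k := k) hS
    simp only [AOWConstraint.signAt]
    exact_mod_cast this
  · simp

/-! ### The level matrix of the sample is the centred random fiber matrix -/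

/-- Entries of the level matrix of a finite SET of constraints. [folklore] -/
theorem levelMatrix_toList_apply (T : Finset (AOWConstraint k n)) (S : Finset (Fin k)) {a b : ℕ}
    (e₁ : Fin a → Fin k) (e₂ : Fin b → Fin k) (u : Fin a → Fin n) (v : Fin b → Fin n) :
    levelMatrix T.toList S e₁ e₂ u v = ∑ C ∈ T, levelEntry C S e₁ e₂ u v := by
  rw [levelMatrix, Matrix.of_apply, Finset.sum_map_toList]

/-- **The cast level matrix of the sample is the centred random fiber matrix** (the centring term
vanishes by sign balance), for `S ≠ ∅`. [Allen–O'Donnell–Witmer 2015, App. A.1 with Cor. 4.2] [cite: arXiv150504383, App. A] -/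
theorem levelMatrix_toList_map_cast (T : Finset (AOWConstraint k n)) {S : Finset (Fin k)}
    (hS : S.Nonempty) {a b : ℕ} (e₁ : Fin a → Fin k) (e₂ : Fin b → Fin k) (p : ℝ) :
    (levelMatrix T.toList S e₁ e₂).map (Int.cast : ℤ → ℝ) =
      randFiberMatrix (fun C : AOWConstraint k n => C.1 ∘ e₁) (fun C => C.1 ∘ e₂)
        (fun C => (C.signAt S : ℝ)) p T := by
  ext u v
  rw [Matrix.map_apply, levelMatrix_toList_apply, randFiberMatrix, fiberMatrix, Matrix.of_apply]
  push_cast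
  -- split the centred weight
  have hsplit : ∀ C : AOWConstraint k n,
      (if C.1 ∘ e₁ = u ∧ C.1 ∘ e₂ = v then (C.signAt S : ℝ) * (ind T C - p) else 0) =
        (if C ∈ T then (if C.1 ∘ e₁ = u ∧ C.1 ∘ e₂ = v then (C.signAt S : ℝ) else 0) else 0) -
          p * (if C.1 ∘ e₁ = u ∧ C.1 ∘ e₂ = v then (1 : ℝ) * (C.signAt S : ℝ) else 0) := by
    intro C
    by_cases hC : C ∈ T <;> by_cases hf : C.1 ∘ e₁ = u ∧ C.1 ∘ e₂ = v <;> simp [hC, hf, ind] <;>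
      ring
  simp_rw [hsplit]
  rw [Finset.sum_sub_distrib, ← Finset.mul_sum, ← Finset.sum_filter, Finset.filter_mem_eq_inter,
    Finset.univ_inter,
    sum_signAt_eq_zero hS (fun T' : Fin k → Fin n => T' ∘ e₁ = u ∧ T' ∘ e₂ = v) (fun _ => 1),
    mul_zero, sub_zero]
  refine Finset.sum_congr rfl fun C _ => ?_
  simp only [levelEntry]
  by_cases h : u = C.1 ∘ e₁ ∧ v = C.1 ∘ e₂
  · rw [if_pos h, if_pos ⟨h.1.symm, h.2.symm⟩]
  · rw [if_neg h, if_neg (fun h' => h ⟨h'.1.symm, h'.2.symm⟩), Int.cast_zero]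

/-! ### The odd tensor of the sample is the centred random tensor -/

/-- Entries of the odd tensor of a finite SET of constraints. [folklore] -/
theorem oddTensor_toList_apply (T : Finset (AOWConstraint k n)) (S : Finset (Fin k)) {r : ℕ}
    (f : Fin (r + r + 1) → Fin k) (i j : Fin r → Fin n) (l : Fin n) :
    oddTensor T.toList S f i j l = ∑ C ∈ T, oddEntry C S f i j l := by
  rw [oddTensor, Finset.sum_map_toList]

/-- **The cast odd tensor of the sample is the centred random tensor**, for `S ≠ ∅`.
[Allen–O'Donnell–Witmer 2015, App. A.2 with Cor. 4.2] [cite: arXiv150504383, App. A.2] -/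
theorem oddTensor_toList_cast (T : Finset (AOWConstraint k n)) {S : Finset (Fin k)} (hS : S.Nonempty)
    {r : ℕ} (f : Fin (r + r + 1) → Fin k) (p : ℝ) :
    (fun i j l => (oddTensor T.toList S f i j l : ℝ)) =
      randTensor (fun C : AOWConstraint k n => C.1 ∘ oddFst f) (fun C => C.1 ∘ oddSnd f)
        (fun C => C.1 (oddLast f)) (fun C => (C.signAt S : ℝ)) p T := by
  funext i j l
  rw [oddTensor_toList_apply, randTensor, tensorOf]
  push_cast
  have hsplit : ∀ C : AOWConstraint k n,
      (if OverTriple (fun C : AOWConstraint k n => C.1 ∘ oddFst f) (fun C => C.1 ∘ oddSnd f)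
          (fun C => C.1 (oddLast f)) C (i, j, l) then (C.signAt S : ℝ) * (ind T C - p) else 0) =
        (if C ∈ T then (if C.1 ∘ oddFst f = i ∧ C.1 ∘ oddSnd f = j ∧ C.1 (oddLast f) = l then
            (C.signAt S : ℝ) else 0) else 0) -
          p * (if C.1 ∘ oddFst f = i ∧ C.1 ∘ oddSnd f = j ∧ C.1 (oddLast f) = l then
            (1 : ℝ) * (C.signAt S : ℝ) else 0) := by
    intro C
    simp only [OverTriple]
    by_cases hC : C ∈ T <;>
      by_cases hf : C.1 ∘ oddFst f = i ∧ C.1 ∘ oddSnd f = j ∧ C.1 (oddLast f) = l <;>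
        simp [hC, hf, ind] <;> ring
  simp_rw [hsplit]
  rw [Finset.sum_sub_distrib, ← Finset.mul_sum, ← Finset.sum_filter, Finset.filter_mem_eq_inter,
    Finset.univ_inter,
    sum_signAt_eq_zero hS (fun T' : Fin k → Fin n =>
      T' ∘ oddFst f = i ∧ T' ∘ oddSnd f = j ∧ T' (oddLast f) = l) (fun _ => 1),
    mul_zero, sub_zero]
  refine Finset.sum_congr rfl fun C _ => ?_
  simp only [oddEntry]
  by_cases h : i = C.1 ∘ oddFst f ∧ j = C.1 ∘ oddSnd f ∧ l = C.1 (oddLast f)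
  · rw [if_pos h, if_pos ⟨h.1.symm, h.2.1.symm, h.2.2.symm⟩]
  · rw [if_neg h, if_neg (fun h' => h ⟨h'.1.symm, h'.2.1.symm, h'.2.2.symm⟩), Int.cast_zero]

/-- The cast of the integer odd matrix is the ring-generic odd matrix of the cast tensor. [folklore] -/
theorem oddMatrix_map_cast {r : ℕ} (w : (Fin r → Fin n) → (Fin r → Fin n) → Fin n → ℤ) :
    (oddMatrix w).map (Int.cast : ℤ → ℝ) = oddMatrixOf fun i j l => (w i j l : ℝ) := by
  ext p q
  simp only [oddMatrix, oddMatrixOf, Matrix.map_apply, Matrix.of_apply]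
  split_ifs <;> push_cast <;> rfl

/-! ### Casting the trace tests to `ℝ` -/

/-- `tr(((B.map ℤ→ℝ)ᵀ(B.map ℤ→ℝ))^q) = ((tr((BᵀB)^q) : ℤ) : ℝ)`. [folklore] -/
theorem trace_pow_map_cast {ι κ : Type} [Fintype ι] [Fintype κ] [DecidableEq κ] (B : Matrix ι κ ℤ)
    (q : ℕ) :
    ((((B.map (Int.cast : ℤ → ℝ))ᵀ * B.map (Int.cast : ℤ → ℝ)) ^ q).trace) =
      ((((Bᵀ * B) ^ q).trace : ℤ) : ℝ) := by
  have hmap : (B.map (Int.cast : ℤ → ℝ))ᵀ * B.map (Int.cast : ℤ → ℝ) =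
      (Bᵀ * B).map (Int.castRingHom ℝ) := by
    rw [Matrix.map_mul, Matrix.transpose_map]
    rfl
  rw [hmap, ← RingHom.mapMatrix_apply, ← map_pow, RingHom.mapMatrix_apply, Matrix.trace, Matrix.trace]
  simp only [Matrix.diag, Matrix.map_apply]
  push_cast
  rfl

/-- The trace of `(BᵀB)^{2^j}` is nonnegative (it is a sum of squares). [folklore] -/
theorem trace_pow_two_pow_nonneg {ι κ : Type} [Fintype ι] [Fintype κ] [DecidableEq κ]
    (B : Matrix ι κ ℝ) (j : ℕ) : 0 ≤ ((Bᵀ * B) ^ 2 ^ j).trace := by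
  have hsq : ∀ {μ : Type} [Fintype μ] (C : Matrix μ κ ℝ), 0 ≤ (Cᵀ * C).trace := by
    intro μ _ C
    simp only [Matrix.trace, Matrix.diag, Matrix.mul_apply, Matrix.transpose_apply]
    exact Finset.sum_nonneg fun i _ => Finset.sum_nonneg fun l _ => mul_self_nonneg _
  cases j with
  | zero => simpa using hsq B
  | succ j =>
    have hM : (Bᵀ * B)ᵀ = Bᵀ * B := by rw [Matrix.transpose_mul, Matrix.transpose_transpose]
    have : (Bᵀ * B) ^ 2 ^ (j + 1) = ((Bᵀ * B) ^ 2 ^ j)ᵀ * (Bᵀ * B) ^ 2 ^ j := by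
      rw [Matrix.transpose_pow, hM, ← pow_add, ← two_mul, ← pow_succ']
    rw [this]
    exact hsq _

/-! ### Fiber sizes -/

/-- **Scopes with prescribed values on the image of an injection**: there are exactly `n^{k-c}`
scopes `T' : [k] → [n]` agreeing with `T` on the image of `e : [c] ↪ [k]`. [folklore] -/
theorem card_filter_scope_comp_eq {c : ℕ} {e : Fin c → Fin k} (he : Function.Injective e)
    (T : Fin k → Fin n) :
    ((univ : Finset (Fin k → Fin n)).filter fun T' => T' ∘ e = T ∘ e).card = n ^ (k - c) := by
  classical
  have hset : ((univ : Finset (Fin k → Fin n)).filter fun T' => T' ∘ e = T ∘ e) =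
      Fintype.piFinset fun i => if i ∈ univ.image e then {T i} else univ := by
    ext T'
    simp only [Finset.mem_filter, Finset.mem_univ, true_and, Fintype.mem_piFinset]
    constructor
    · intro h i
      split_ifs with hi
      · obtain ⟨j, -, rfl⟩ := Finset.mem_image.1 hi
        rw [Finset.mem_singleton]
        exact congr_fun h j
      · exact Finset.mem_univ _
    · intro h
      funext j
      have := h (e j)
      rw [if_pos (Finset.mem_image_of_mem _ (Finset.mem_univ _)), Finset.mem_singleton] at this
      exact this
  rw [hset, Fintype.card_piFinset]
  have hcard : ∀ i, (if i ∈ univ.image e then ({T i} : Finset (Fin n)) else univ).card =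
      if i ∈ univ.image e then 1 else n := fun i => by split_ifs <;> simp
  simp_rw [hcard]
  rw [Finset.prod_ite, Finset.prod_const_one, one_mul, Finset.prod_const]
  congr 1
  rw [Finset.filter_not, Finset.filter_mem_eq_inter, Finset.univ_inter, Finset.card_sdiff_of_subset
    (Finset.subset_univ _), Finset.card_univ, Fintype.card_fin, Finset.card_image_of_injective _ he,
    Finset.card_univ, Fintype.card_fin]

/-- The number of constraints whose scope agrees with a given one on the image of an injection
`e : [c] ↪ [k]` is `2^k n^{k-c}`. [folklore] -/
theorem card_filter_constraint_comp_eq {c : ℕ} {e : Fin c → Fin k} (he : Function.Injective e)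
    (C : AOWConstraint k n) :
    ((univ : Finset (AOWConstraint k n)).filter fun C' => C'.1 ∘ e = C.1 ∘ e).card =
      n ^ (k - c) * 2 ^ k := by
  have hset : ((univ : Finset (AOWConstraint k n)).filter fun C' => C'.1 ∘ e = C.1 ∘ e) =
      ((univ : Finset (Fin k → Fin n)).filter fun T' => T' ∘ e = C.1 ∘ e) ×ˢ
        (univ : Finset (Fin k → Bool)) := by
    ext C'
    simp
  rw [hset, Finset.card_product, card_filter_scope_comp_eq he, Finset.card_univ, Fintype.card_fun,
    Fintype.card_bool, Fintype.card_fin]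

/-- At most `2^k` constraints (the sign patterns) lie over a triple of an odd split `f : [k] ≃ [k]`
(indeed over any prescription of the whole scope). [Allen–O'Donnell–Witmer 2015, Cor. 4.2] [folklore] -/
theorem card_filter_overTriple_le {r : ℕ} (f : Fin (r + r + 1) → Fin k) (hf : Function.Injective f)
    (hk : k = r + r + 1) (τ : (Fin r → Fin n) × (Fin r → Fin n) × Fin n) :
    ((univ : Finset (AOWConstraint k n)).filter fun C =>
        OverTriple (fun C : AOWConstraint k n => C.1 ∘ oddFst f) (fun C => C.1 ∘ oddSnd f)
          (fun C => C.1 (oddLast f)) C τ).card ≤ 2 ^ k := by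
  -- `f` is a bijection, so a triple determines the scope
  have hbij : Function.Bijective f := by
    rw [Fintype.bijective_iff_injective_and_card]
    exact ⟨hf, by simp [hk]⟩
  -- two constraints over the same triple have the same scope
  have hscope : ∀ C C' : AOWConstraint k n,
      OverTriple (fun C : AOWConstraint k n => C.1 ∘ oddFst f) (fun C => C.1 ∘ oddSnd f)
          (fun C => C.1 (oddLast f)) C τ →
      OverTriple (fun C : AOWConstraint k n => C.1 ∘ oddFst f) (fun C => C.1 ∘ oddSnd f)
          (fun C => C.1 (oddLast f)) C' τ → C.1 = C'.1 := by
    intro C C' h h'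
    obtain ⟨h1, h2, h3⟩ := h
    obtain ⟨h1', h2', h3'⟩ := h'
    funext x
    obtain ⟨y, rfl⟩ := hbij.2 x
    -- `y` lies in one of the three blocks of `[r + r + 1]`
    refine Fin.addCases (fun y' => ?_) (fun y' => ?_) y
    · refine Fin.addCases (fun y'' => ?_) (fun y'' => ?_) y'
      · have := congr_fun (h1.trans h1'.symm) y''
        simpa [oddFst] using this
      · have := congr_fun (h2.trans h2'.symm) y''
        simpa [oddSnd] using this
    · have hy' : y' = 0 := Fin.eq_zero y'
      subst hy'
      simpa [oddLast] using h3.trans h3'.symm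
  by_cases hne : ((univ : Finset (AOWConstraint k n)).filter fun C =>
      OverTriple (fun C : AOWConstraint k n => C.1 ∘ oddFst f) (fun C => C.1 ∘ oddSnd f)
        (fun C => C.1 (oddLast f)) C τ).Nonempty
  · obtain ⟨C₀, hC₀⟩ := hne
    have hC₀' := (Finset.mem_filter.1 hC₀).2
    calc _ ≤ ((univ : Finset (AOWConstraint k n)).filter fun C => C.1 = C₀.1).card := by
          refine Finset.card_le_card fun C hC => ?_
          exact Finset.mem_filter.2 ⟨Finset.mem_univ _, hscope C C₀ (Finset.mem_filter.1 hC).2 hC₀'⟩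
      _ = 2 ^ k := by
          have hset : ((univ : Finset (AOWConstraint k n)).filter fun C => C.1 = C₀.1) =
              ({C₀.1} : Finset (Fin k → Fin n)) ×ˢ (univ : Finset (Fin k → Bool)) := by
            ext C
            simp [Prod.ext_iff, eq_comm]
          rw [hset, Finset.card_product, Finset.card_singleton, one_mul, Finset.card_univ,
            Fintype.card_fun, Fintype.card_bool, Fintype.card_fin]
  · rw [Finset.not_nonempty_iff_eq_empty.1 hne, Finset.card_empty]
    positivity

/-! ### Concentration of the number of constraints -/

/-- **`P[m < m̄/2] ≤ 4/m̄`** (Chebyshev; AOW Fact 3.6, first item, in the weak form used here),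
`m̄ = |Λ| p > 0`. [Allen–O'Donnell–Witmer 2015, Fact 3.6] [cite: arXiv150504383, Fact 3.6] -/
theorem subsetProb_card_lt_half_le {Λ : Type} [Fintype Λ] [DecidableEq Λ] {p : ℝ} (hp0 : 0 ≤ p)
    (hp1 : p ≤ 1) (hm : 0 < Fintype.card Λ * p) :
    subsetProb Λ p (fun T => (T.card : ℝ) < Fintype.card Λ * p / 2) ≤ 4 / (Fintype.card Λ * p) := by
  set mbar := (Fintype.card Λ : ℝ) * p with hmbar
  have hθ : 0 < (mbar / 2) ^ 2 := by positivity
  calc subsetProb Λ p (fun T => (T.card : ℝ) < mbar / 2)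
      ≤ subsetProb Λ p (fun T => (mbar / 2) ^ 2 ≤ ((T.card : ℝ) - mbar) ^ 2) := by
        refine subsetProb_mono p fun T hT => ?_
        have h1 : mbar / 2 ≤ mbar - T.card := by linarith
        have h2 : 0 ≤ mbar / 2 := by positivity
        calc (mbar / 2) ^ 2 ≤ (mbar - T.card) ^ 2 := pow_le_pow_left₀ h2 h1 2
          _ = ((T.card : ℝ) - mbar) ^ 2 := by ring
    _ ≤ subsetExp Λ p (fun T => ((T.card : ℝ) - mbar) ^ 2) / (mbar / 2) ^ 2 :=
        subsetProb_le_subsetExp_div p (fun T => sq_nonneg _) hθ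
    _ = Fintype.card Λ * (p * (1 - p)) / (mbar / 2) ^ 2 := by rw [hmbar, subsetExp_card_sub_sq hp0 hp1]
    _ ≤ mbar / (mbar / 2) ^ 2 := by
        apply div_le_div_of_nonneg_right _ hθ.le
        rw [hmbar]
        have : (Fintype.card Λ : ℝ) * (p * (1 - p)) = Fintype.card Λ * p * (1 - p) := by ring
        rw [this]
        exact mul_le_of_le_one_right hm.le (by linarith)
    _ = 4 / mbar := by
        field_simp
        ring

end Literature.Computability.Complexity
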